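import Summits.BirchSwinnertonDyer.BirchSwinnertonDyer.Theorems.SchneiderFreeAdditiveX3KYReadHypsBranch
import Summits.BirchSwinnertonDyer.BirchSwinnertonDyer.Theorems.SchneiderFreeAdditiveX3KYReadLogDescent
import Summits.BirchSwinnertonDyer.BirchSwinnertonDyer.Theorems.SchneiderFreeAdditiveX3KYReadEmbAtCompat
import Literature.NumberTheory.EllipticCurves.ModularCurveManinConstantProofs
import Literature.NumberTheory.EllipticCurves.SerreOpenImageOrdinaryInertiaProofs
import HarnessLib
import HarnessLib.Audit.Tags

/-!
# Route `SchneiderFreeAdditiveX3` (K1 door), crux `GordTwoBranchIMC` (stmt-BirchSwinnertonDyer-19177):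
# the VALUE HALF of `stub_CH` at every `μ = 0` frame ⇐ Castella–Hsieh's value at THEIR frame
# + "all `μ = 0` frames generate the same ideal" (Keller–Yin) — the reduction of `KYRead.KYReadCHValue`

Cell `bsd-schneider-ideate` (HOME `run/shared/lean/pub/bsd-schneider-ideate/`), seat `door-c3` gen 10.
PARTITION: board row B6 ∩ X3 ∩ sst-twist, r = 1, (G-ord, `e = 2`) half (2 560 of 7 101 pairs) of
`Rank1Residual.partition`; SHRINKS crux r3's last untyped input: the hypothesis `hval` =
`KYRead.KYReadCHValue` (value formula with INTEGRAL cofactor at EVERY `μ = 0` branch frame, logarithm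
DESCENDED to `W(K)` at `embAt K p 𝔭′`) of the socket theorem
`additiveIMCLowerBDPOnTreeLeAt_of_KY_branch_of_valueAt_conj` (`…GordTwoBranchIMCOfKYBranch.lean`) is
DERIVED (`hval_of_CH_frame_value`) from: (i) the PRINTED-shape value at ONE frame (Castella–Hsieh's:
`L_c(𝟙) = u_c·(log_{ω_{W′}} z)²`, `u_c ∈ R₀`, log over `ℂ_p` along `ι′⁻¹` of the genus-twisted
conductor-`p` trace `z ∈ W′(K[p])` — cite item wi-73260, typer lane, unblocked since p495646);
(ii) "every `μ = 0` frame generates the same ideal" (Keller–Yin Thm. 3.5.1 (iii) branch currency +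
its `μ`-clause for Castella–Hsieh's normalisation — both typed `_OPEN`, PREPRINT); using this
generation's theorems: value transfer (`exists_unit_forall_hasValueAt_zero_of_span_eq`), the twist
descent of the logarithm (`…KYReadLogDescent.lean`, p508017; its classical `DecidableEq K[p]` is bridged to the door's subtype instance by `convert`/`Subsingleton.elim` — `Decidable` is data), the embedding compatibility
(`…KYReadEmbAtCompat.lean`, p508716) and the general change-of-variables rule for `log_ω` (p502421/p503655).
Closes nothing (BSD not advanced): the crux stays OPEN behind the Keller–Yin preprint claims and the
typed Castella–Hsieh value formula; but the `KYReadCHValue` node of the H-record is now ONE typed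
published input + two named preprint clauses + theorems.

Next assembly (not here): `additiveIMCLowerBDPOnTreeLeAt_of_CH_branch` := the socket theorem with
`hval := hval_of_CH_frame_value …`, `hspan` from `thm351_charIdeal_eq_branch_OPEN` at the good member
(`potOrdSetting_of_socketData`, `charIdeal_map_eq_span_of_branch_OPEN_of_not_dvd`), `hμ_c` from
`thm351_mu_zero_branch_OPEN`, the frame and `hval_c` from the typed wi-73260.
-/

noncomputable section

open scoped Classical NNReal

open WeierstrassCurve NumberField IsDedekindDomain Field PowerSeries
  Literature.NumberTheory.EllipticCurves
  Literature.NumberTheory.EllipticCurves.ModularForms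
  Literature.NumberTheory.EllipticCurves.FormalGroupChart
  Literature.NumberTheory.EllipticCurves.KellerYin2024
  Summit.BirchSwinnertonDyer.Rank1Residual
  Summit.BirchSwinnertonDyer.Rank1Residual.X11b
  Summit.BirchSwinnertonDyer.Rank1Residual.X11b.Halves

set_option linter.dupNamespace false
set_option autoImplicit false

namespace Summit.BirchSwinnertonDyer.BirchSwinnertonDyer.Theorems.SchneiderFree.KYRead.LogDescent



/-! ## Value transfer and the reduction -/

variable {p : ℕ} [Fact p.Prime]

/-- Value transfer, uniform form: if `(L) = (L′)` in `R₀⟦T⟧` there is ONE unit `U ∈ R₀ˣ` with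
`L(𝟙) = U·v` whenever `L′(𝟙) = v`. [cite: Washington1997, §7.1] [cite: Castella2018, §2.2] -/
theorem exists_unit_forall_hasValueAt_zero_of_span_eq {L L' : UnrSeries p}
    (h : Ideal.span {L} = Ideal.span {L'}) :
    ∃ U : (unrIntegers p)ˣ, ∀ v : ℂ_[p], L'.HasValueAt 0 v →
      L.HasValueAt 0 (((U : unrIntegers p) : ℂ_[p]) * v) := by
  obtain ⟨u, hu⟩ := Ideal.span_singleton_eq_span_singleton.mp h.symm
  have hU : IsUnit (PowerSeries.constantCoeff (u : UnrSeries p)) :=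
    PowerSeries.isUnit_constantCoeff _ u.isUnit
  refine ⟨hU.unit, fun v hv ↦ ?_⟩
  rw [UnrSeries.eq_constantCoeff_of_hasValueAt_zero hv, ← Subring.coe_mul, IsUnit.unit_spec,
    mul_comm, ← map_mul, hu]
  exact L.hasValueAt_zero

/-- A `p`-adic number of norm `≤ 1` read in `ℂ_p` lies in `R₀` (through `ℤ_p → R₀`, `toUnr`).
[cite: Castella2018, §3 (p. 9) (R₀ contains ℤ_p)] -/
theorem exists_unr_coe_eq_of_norm_le_one {x : ℚ_[p]} (hx : ‖x‖ ≤ 1) :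
    ∃ r : unrIntegers p, ((r : unrIntegers p) : ℂ_[p]) = algebraMap ℚ_[p] ℂ_[p] x :=
  ⟨toUnr p ⟨x, hx⟩, by rw [coe_toUnr]⟩

/-- The bookkeeping identity behind the cofactor (any field). [folklore] -/
theorem cofactor_identity {F : Type*} [Field F] (U uc d c u X : F) (hc : c ≠ 0) (hu : u ≠ 0) :
    U * (uc * (d * u⁻¹ ^ 2 * X ^ 2)) = U * uc * (d * c ^ 2 / u ^ 2) * (X / c) ^ 2 := by
  field_simp

/-- `ℚ → ℚ_p → ℂ_p` is `ℚ → ℂ_p`. [folklore] -/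
theorem algebraMap_ratCast_padicComplex (q : ℚ) :
    algebraMap ℚ_[p] ℂ_[p] (q : ℚ_[p]) = algebraMap ℚ ℂ_[p] q := by
  rw [map_ratCast, eq_ratCast]

section Main

variable (W' : WeierstrassCurve ℚ) [W'.IsGloballyMinimal]
  [NeZero (W'.conductorNorm ℤ)] (hgood : W'.HasGoodReductionAtPrime p) (D C₂ : VariableChange ℚ) [(D • W').IsCharNeTwoNF]
  [(C₂ • (D • W').quadraticTwist ((-1 : ℚ) ^ (p / 2) * p)).IsElliptic]
  [(C₂ • (D • W').quadraticTwist ((-1 : ℚ) ^ (p / 2) * p)).IsGloballyMinimal]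
  {N : ℕ} {K : Type} [Field K] [NumberField K] [IsGalois ℚ K] (h2 : Module.finrank ℚ K = 2)
  (H : HeegnerDatum N (NumberField.discr K))
  {κ : ZpExtension K p} {γ : Field.absoluteGaloisGroup K}
  {𝔭 𝔭' : HeightOneSpectrum (𝓞 K)} (h𝔭 : ((p : ℕ) : 𝓞 K) ∈ 𝔭.asIdeal)
  (he : 𝔭.asIdeal.ramificationIdx (𝓞 ℚ) = 1) (hf : 𝔭.asIdeal.inertiaDeg (𝓞 ℚ) = 1)
  (h𝔭' : ((p : ℕ) : 𝓞 K) ∈ 𝔭'.asIdeal)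
  (he' : 𝔭'.asIdeal.ramificationIdx (𝓞 ℚ) = 1) (hf' : 𝔭'.asIdeal.inertiaDeg (𝓞 ℚ) = 1)
  (hne : 𝔭 ≠ 𝔭') (ι' : PadicAlgCl p ≃+* ℂ) (ιc : K →+* ℂ) [NumberField (ringClassField K ιc p)]
  (hind : ∀ k : 𝓞 K, k ∈ 𝔭'.asIdeal ↔ ‖ι'.symm (ιc (k : K))‖ < 1)
  (Dt' : ModularParametrizationData W' (W'.conductorNorm ℤ))
  (I : Ideal (UnrSeries p))
  (hspan : ∀ (e : ℂ) (ΩK : ℂ) (Ωp : (unrIntegers p)ˣ) (L : UnrSeries p), e ≠ 0 → ΩK ≠ 0 →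
    IsBranchBDPLFunction ι' 𝔭' κ γ Dt'.f (genusHeckeCharacter K p) e ΩK
      ((Ωp : unrIntegers p) : ℂ_[p]) L →
    ¬ C (p : unrIntegers p) ∣ L → I = Ideal.span {L})
  {e_c : ℂ} {ΩK_c : ℂ} {Ωp_c : (unrIntegers p)ˣ} {L_c : UnrSeries p} (he_c : e_c ≠ 0)
  (hΩK_c : ΩK_c ≠ 0)
  (hL_c : IsBranchBDPLFunction ι' 𝔭' κ γ Dt'.f (genusHeckeCharacter K p) e_c ΩK_c
    ((Ωp_c : unrIntegers p) : ℂ_[p]) L_c)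
  (hμ_c : ¬ C (p : unrIntegers p) ∣ L_c) (u_c : unrIntegers p)
  (hval_c : ∀ (y : (W'.baseChange (ringClassField K ιc p : Type)).toAffine.Point),
    WeierstrassCurve.Affine.Point.map (ringClassField K ιc p).subtype.toRatAlgHom y =
      heegnerPointComplexOfConductor Dt' (NumberField.discr K) H.β p →
    ∀ (θ : ringClassField K ιc p)
      (_ : θ ^ 2 = algebraMap ℚ (ringClassField K ιc p) ((-1 : ℚ) ^ (p / 2) * p)) (_ : θ ≠ 0)
      (s : ringClassGal ιc p → ℤˣ),
      (∀ σ : ringClassGal ιc p, σ.1 θ = ((s σ : ℤ) : ringClassField K ιc p) * θ) →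
      L_c.HasValueAt 0 (((u_c : unrIntegers p) : ℂ_[p]) *
        (@padicLogPointFiniteExt ℂ_[p] _ NormedField.valuation (W'.baseChange ℂ_[p]) p
          (isIntegral_valuation_baseChange W' ℂ_[p])
          (WeierstrassCurve.Affine.Point.map
            ((algebraMap (PadicAlgCl p) ℂ_[p]).comp
              (ι'.symm.toRingHom.comp (ringClassField K ιc p).subtype)).toRatAlgHom
            (∑ τ : ringClassGal ιc p,
              (s τ : ℤ) • pointGalHom W' (ringClassField K ιc p : Type) τ.1 y))) ^ 2))

include hgood h2 h𝔭 he hf hne hind hspan he_c hΩK_c hL_c hμ_c hval_c in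
/-- **The value half of `stub_CH` at EVERY `μ = 0` branch frame, from Castella–Hsieh's value at ONE frame.**
Setting: the door's presented curve `W = C₂ • ((D • W′) ⊗ χ_{p*})`, `W′` globally minimal with good
reduction at `p`, `K` imaginary quadratic (`[K:ℚ] = 2`), the split prime `p = 𝔭𝔭′` (both of degree
one, `𝔭 ≠ 𝔭′`), an embedding datum `ι′` such that `ι′⁻¹ ∘ ι_c` INDUCES `𝔭′` on `𝓞 K` (`hind`; `ι_c` the
complex embedding carrying the ring class field `K[p]` and the Heegner points), a parametrisation datum
`Dt′` of `W′`. Inputs: (i) `hspan` — every `μ = 0` branch frame of `(Dt′.f, χ_ε)` at `𝔭′` generates one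
and the same ideal `I` of `R₀⟦T⟧` (on the door: Keller–Yin Thm. 3.5.1 (iii) in branch currency,
`thm351_charIdeal_eq_branch_OPEN`, at the good member — `I = Char_Λ(𝔛)·R₀⟦T⟧`); (ii) ONE `μ = 0` frame
`L_c` (on the door: Castella–Hsieh's own frame, `μ(L_c) = 0` being Keller–Yin's clause
`thm351_mu_zero_branch_OPEN`) with the VALUE FORMULA in printed shape — `L_c(𝟙) = u_c · (log_{ω_{W′}} z)²`,
`u_c ∈ R₀`, the logarithm of the genus-twisted trace `z = Σ_τ s(τ) τy ∈ W′(K[p])` read in `ℂ_p` along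
`ι′⁻¹` (Castella–Hsieh Thm. 5.7 / (eq:bdp) + Lemma 5.4: the printed cofactor `𝔤(χ_{ε,𝔭})²·units` is
`p`-integral; cite item wi-73260). OUTPUT: VERBATIM the value hypothesis `hval` of the socket theorem
`additiveIMCLowerBDPOnTreeLeAt_of_KY_branch_of_valueAt_conj` (= `KYRead.KYReadCHValue` at this datum):
at every `μ = 0` frame `L`, an INTEGRAL `u ∈ R₀` with `L(𝟙) = u·(log_{ω_W}(Q)/c′)²` for every descended
`Q`. Proof: value transfer along `(L) = (L_c)` (unit `U(0)`), the twist descent of the logarithm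
(`sq_padicLog_map_eq_of_descent`, along `ι′⁻¹|_{K[p]}` which restricts to `embAt K p 𝔭′` by
`symm_apply_eq_embAt_of_forall_mem_iff_norm_lt_one`), and `p`-integrality of `p*·c′²/(u_{C₂}u_D)²`
(`‖u_{C₂}u_D‖ ≥ ‖√p*‖` from `one_le_val_u_of_smul_eq` at a square root of `p*` in `ℂ_p`); the cofactor is
`u = U(0)·u_c·p*c′²/(u_{C₂}u_D)²`. CONDITIONAL only on its displayed hypotheses; nothing about BSD.
[cite: CastellaHsieh2018, Thm. 5.7 and Lemma 5.4 (arXiv:1505.08165 pp. 17–19) (shape of hval_c)]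
[cite: KellerYin2024b, Thm. 3.5.1 (arXiv:2410.23241 p. 20) (shape of hspan; preprint)] -/
theorem hval_of_CH_frame_value :
    ∀ (e : ℂ) (ΩK : ℂ) (Ωp : (unrIntegers p)ˣ) (L : UnrSeries p), e ≠ 0 → ΩK ≠ 0 →
      IsBranchBDPLFunction ι' 𝔭' κ γ Dt'.f (genusHeckeCharacter K p) e ΩK
        ((Ωp : unrIntegers p) : ℂ_[p]) L →
      ¬ C (p : unrIntegers p) ∣ L →
      ∃ u : unrIntegers p,
      ∀ (y : (W'.baseChange (ringClassField K ιc p : Type)).toAffine.Point),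
      WeierstrassCurve.Affine.Point.map (ringClassField K ιc p).subtype.toRatAlgHom y =
        heegnerPointComplexOfConductor Dt' (NumberField.discr K) H.β p →
      ∀ (θ : ringClassField K ιc p)
      (hθ2 : θ ^ 2 = algebraMap ℚ (ringClassField K ιc p) ((-1 : ℚ) ^ (p / 2) * p)) (hθ : θ ≠ 0)
      (s : ringClassGal ιc p → ℤˣ),
      (∀ σ : ringClassGal ιc p, σ.1 θ = ((s σ : ℤ) : ringClassField K ιc p) * θ) →
      ∀ Q : ((C₂ • (D • W').quadraticTwist ((-1 : ℚ) ^ (p / 2) * p)).baseChange K).toAffine.Point,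
      Affine.Point.map (algebraMap K (ringClassField K ιc p)).toRatAlgHom Q =
        VariableChange.pointEquivBaseChange ((D • W').quadraticTwist ((-1 : ℚ) ^ (p / 2) * p)) C₂
          (ringClassField K ιc p)
          ((VariableChange.pointEquiv (((D • W').quadraticTwist ((-1 : ℚ) ^ (p / 2) * p)).baseChange
              (ringClassField K ιc p : Type)) (untwistAt hθ)).symm
            ((Affine.Point.congrEquiv (untwistAt_smul_eq (D • W') hθ2 hθ)).symm
              (VariableChange.pointEquivBaseChange W' D (ringClassField K ιc p)
                (∑ τ : ringClassGal ιc p,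
                  (s τ : ℤ) • pointGalHom W' (ringClassField K ιc p : Type) τ.1 y)))) →
      L.HasValueAt 0 (((u : unrIntegers p) : ℂ_[p]) *
        (algebraMap ℚ_[p] ℂ_[p] (logOmega (C₂ • (D • W').quadraticTwist ((-1 : ℚ) ^ (p / 2) * p))
          p (embAt K p 𝔭' h𝔭' he' hf') Q / (Dt'.c : ℚ_[p]))) ^ 2) := by
  intro e ΩK Ωp L he0 hΩK hL hμ
  -- (1) the two `μ = 0` frames generate the same ideal: value transfer up to a unit `U`
  have hLL : Ideal.span {L} = Ideal.span {L_c} :=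
    (hspan e ΩK Ωp L he0 hΩK hL hμ).symm.trans (hspan e_c ΩK_c Ωp_c L_c he_c hΩK_c hL_c hμ_c)
  obtain ⟨U, hU⟩ := exists_unit_forall_hasValueAt_zero_of_span_eq hLL
  -- (2) the rational factor `p* · c′² / (u_{C₂}u_D)²` is `p`-integral
  have hΔ' : ¬ (p : ℤ) ∣ minimalDiscriminantInt W' :=
    W'.not_dvd_minimalDiscriminantInt_of_hasGoodReductionAtPrime' p hgood
  have hp : (p : ℚ) ≠ 0 := Nat.cast_ne_zero.mpr (Fact.out : p.Prime).ne_zero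
  have hd0 : ((-1 : ℚ) ^ (p / 2) * p : ℚ) ≠ 0 := mul_ne_zero (pow_ne_zero _ (by norm_num)) hp
  obtain ⟨θ₀, hθ₀⟩ := IsAlgClosed.exists_pow_nat_eq (algebraMap ℚ ℂ_[p] ((-1 : ℚ) ^ (p / 2) * p))
    (by norm_num : 0 < 2)
  have hθ₀0 : θ₀ ≠ 0 := by
    intro h0
    rw [h0, zero_pow two_ne_zero, eq_comm, _root_.map_eq_zero] at hθ₀
    exact hd0 hθ₀
  have hee : ∀ x : ℚ_[p], ‖algebraMap ℚ_[p] ℂ_[p] x‖ = ‖x‖ := fun x ↦ PadicComplex.norm_extends' (p := p) x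
  have hCV := compositeChange_smul (L := ℂ_[p]) W' D C₂ ((-1 : ℚ) ^ (p / 2) * p) hθ₀ hθ₀0
  have hu1 := one_le_val_u_of_smul_eq p W' D C₂ ((-1 : ℚ) ^ (p / 2) * p) (algebraMap ℚ_[p] ℂ_[p])
    hee hCV hΔ'
  rw [compositeChange_u (L := ℂ_[p]) D C₂ hθ₀0, NormedField.valuation_apply, ← NNReal.coe_le_coe,
    NNReal.coe_one, coe_nnnorm, norm_mul, norm_inv] at hu1
  -- `‖θ₀‖² = ‖p*‖ = p⁻¹` and `‖θ₀‖ ≤ ‖u_{C₂} u_D‖`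
  have hθn : ‖θ₀‖ ^ 2 = (p : ℝ)⁻¹ := by
    rw [← norm_pow, hθ₀, ← algebraMap_ratCast_padicComplex, hee]
    push_cast
    rw [norm_mul, norm_pow, norm_neg, norm_one, one_pow, one_mul, Padic.norm_p]
  have hθpos : 0 < ‖θ₀‖ := norm_pos_iff.mpr hθ₀0
  have hule : ‖θ₀‖ ≤ ‖algebraMap ℚ ℂ_[p] (C₂.u * D.u : ℚ)‖ := by
    have h := mul_le_mul_of_nonneg_right hu1 hθpos.le
    rwa [one_mul, mul_assoc, inv_mul_cancel₀ hθpos.ne', mul_one] at h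
  have hu0 : (C₂.u * D.u : ℚ) ≠ 0 := mul_ne_zero C₂.u.ne_zero D.u.ne_zero
  have hu0' : algebraMap ℚ ℂ_[p] (C₂.u * D.u : ℚ) ≠ 0 := by rw [map_ne_zero]; exact hu0
  have hnorm : ‖(((-1 : ℚ) ^ (p / 2) * p * (Dt'.c : ℚ) ^ 2 / (C₂.u * D.u : ℚ) ^ 2 : ℚ) : ℚ_[p])‖ ≤ 1 := by
    have hupos : 0 < ‖algebraMap ℚ ℂ_[p] (C₂.u * D.u : ℚ)‖ := norm_pos_iff.mpr hu0'
    rw [← hee, algebraMap_ratCast_padicComplex]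
    rw [map_div₀, map_mul, map_pow, map_pow, norm_div, norm_mul, norm_pow, norm_pow,
      div_le_one (pow_pos hupos 2)]
    have h1 : ‖algebraMap ℚ ℂ_[p] ((-1 : ℚ) ^ (p / 2) * p)‖ = (p : ℝ)⁻¹ := by rw [← hθ₀, norm_pow, hθn]
    have h2 : ‖algebraMap ℚ ℂ_[p] (Dt'.c : ℚ)‖ ≤ 1 := by
      rw [← algebraMap_ratCast_padicComplex, hee, Rat.cast_intCast]
      exact Padic.norm_int_le_one _
    calc ‖algebraMap ℚ ℂ_[p] ((-1 : ℚ) ^ (p / 2) * p)‖ * ‖algebraMap ℚ ℂ_[p] (Dt'.c : ℚ)‖ ^ 2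
        ≤ (p : ℝ)⁻¹ * 1 ^ 2 := by rw [h1]; gcongr
      _ = ‖θ₀‖ ^ 2 := by rw [one_pow, mul_one, hθn]
      _ ≤ ‖algebraMap ℚ ℂ_[p] (C₂.u * D.u : ℚ)‖ ^ 2 := by gcongr
  obtain ⟨r, hr⟩ := exists_unr_coe_eq_of_norm_le_one hnorm
  -- (3) the cofactor
  refine ⟨(U : unrIntegers p) * u_c * r, ?_⟩
  intro y hy θ hθ2 hθ s hs Q hQ
  have hv := hU _ (hval_c y hy θ hθ2 hθ s hs)
  -- (4) the descent of the logarithm along `ι′⁻¹|_{K[p]}`, which restricts to `embAt K p 𝔭′` on `K`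
  have hj : ∀ x : K, ((algebraMap (PadicAlgCl p) ℂ_[p]).comp
      (ι'.symm.toRingHom.comp (ringClassField K ιc p).subtype)) (algebraMap K (ringClassField K ιc p) x)
      = algebraMap ℚ_[p] ℂ_[p] (embAt K p 𝔭' h𝔭' he' hf' x) := by
    intro x
    rw [RingHom.comp_apply, RingHom.comp_apply, Subfield.coe_subtype, coe_algebraMap_ringClassField,
      RingEquiv.toRingHom_eq_coe, RingEquiv.coe_toRingHom,
      symm_apply_eq_embAt_of_forall_mem_iff_norm_lt_one h2 h𝔭 he hf h𝔭' he' hf' hne ι' ιc hind x,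
      ← IsScalarTower.algebraMap_apply]
  -- (the landed descent theorem carries the classical `DecidableEq K[p]`; `hQ` the subtype one —
  -- `Decidable` is data, `convert` bridges the two renderings by `Subsingleton.elim`)
  have hd := sq_padicLog_map_eq_of_descent p W' D C₂ ((-1 : ℚ) ^ (p / 2) * p) hθ2 hθ
    (∑ τ : ringClassGal ιc p, (s τ : ℤ) • pointGalHom W' (ringClassField K ιc p : Type) τ.1 y) Q
    (by convert hQ) (embAt K p 𝔭' h𝔭' he' hf') (algebraMap ℚ_[p] ℂ_[p]) hee _ hj hΔ'
  -- replace `(log z)²` by the descended expression (the two renderings of `ℂ_p`'s instances agree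
  -- definitionally; `convert` closes them)
  have hv' : L.HasValueAt 0 (((U : unrIntegers p) : ℂ_[p]) * (((u_c : unrIntegers p) : ℂ_[p]) *
      (algebraMap ℚ ℂ_[p] ((-1 : ℚ) ^ (p / 2) * p) * (algebraMap ℚ ℂ_[p] (C₂.u * D.u : ℚ))⁻¹ ^ 2 *
        (algebraMap ℚ_[p] ℂ_[p] (logOmega (C₂ • (D • W').quadraticTwist ((-1 : ℚ) ^ (p / 2) * p)) p
          (embAt K p 𝔭' h𝔭' he' hf') Q)) ^ 2))) := by
    convert hv using 3
    exact hd.symm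
  -- (5) bookkeeping
  have hcZ : Dt'.c ≠ 0 := Dt'.maninConstant_ne_zero_holds
  have hc0 : algebraMap ℚ_[p] ℂ_[p] (Dt'.c : ℚ_[p]) ≠ 0 := by
    rw [map_ne_zero]; exact_mod_cast hcZ
  have key := cofactor_identity (((U : unrIntegers p) : ℂ_[p])) ((u_c : unrIntegers p) : ℂ_[p])
    (algebraMap ℚ ℂ_[p] ((-1 : ℚ) ^ (p / 2) * p)) (algebraMap ℚ_[p] ℂ_[p] (Dt'.c : ℚ_[p]))
    (algebraMap ℚ ℂ_[p] (C₂.u * D.u : ℚ))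
    (algebraMap ℚ_[p] ℂ_[p] (logOmega (C₂ • (D • W').quadraticTwist ((-1 : ℚ) ^ (p / 2) * p)) p
      (embAt K p 𝔭' h𝔭' he' hf') Q)) hc0 hu0'
  rw [key] at hv'
  have hr' : ((r : unrIntegers p) : ℂ_[p]) = algebraMap ℚ ℂ_[p] ((-1 : ℚ) ^ (p / 2) * p) *
      (algebraMap ℚ_[p] ℂ_[p] (Dt'.c : ℚ_[p])) ^ 2 / (algebraMap ℚ ℂ_[p] (C₂.u * D.u : ℚ)) ^ 2 := by
    rw [hr, algebraMap_ratCast_padicComplex, map_div₀, map_mul, map_pow, map_pow,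
      ← algebraMap_ratCast_padicComplex (Dt'.c : ℚ), Rat.cast_intCast]
  rw [Subring.coe_mul, Subring.coe_mul, hr', map_div₀]
  exact hv'

end Main

end Summit.BirchSwinnertonDyer.BirchSwinnertonDyer.Theorems.SchneiderFree.KYRead.LogDescent

end
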